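import Summits.Ventures.PackingBounds.ThreePointCert.S4T11Proof
import Summits.Ventures.PackingBounds.ThreePointCert.S4T12Proof
import Summits.Ventures.PackingBounds.ThreePointCert.S4T13Proof
import Summits.Ventures.PackingBounds.ThreePointCert.S4T14Proof
import Summits.Ventures.PackingBounds.ThreePointCert.S4T15Proof
import Summits.Ventures.PackingBounds.SphericalCodes.TammesReading

/-!
# Tammes-type angles on `S⁴`, `N = 11, …, 15` points: readings of the kernel-checked three-point rows (table B2d)

Framing: lottery ticket; floor = certified bounds/negative ranges. Venture `PackingBounds` (cell `pub-packcert`),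
spherical-codes family, table B2d = the ten open cells of Pfender's 2007 Table 2 (Tammes-type angles on `S³` and `S⁴`).

For `N = 11, …, 15` the tree holds the kernel-checked Bachoc–Vallentin three-point certificates
`ThreePointCert.S4T<N>.tammesS4_<N>_card_le_<N-1>_sdp` (`n = 5`, degree 10, Bachoc–Vallentin multiplier set): every finite set
of unit vectors of `ℝ⁵` with pairwise inner products `≤ s_N` has at most `N - 1` elements.  Read in Tammes form (pattern of
`TammesEighteen.lean`): among any `N` unit vectors of `ℝ⁵` (points of `S⁴`) two distinct ones make an angle `< arccos s_N`, i.e. the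
largest possible minimum angle of `N` points on `S⁴` is `< arccos s_N`.

| `N` | `s_N` | `arccos s_N` | Pfender 2007 Table 2 (print, degrees) |
|---|---|---|---|
| 11 | `931/10000` | `84.6580…°` | `85.39` |
| 12 | `631/5000` | `82.7499…°` | `83.14` |
| 13 | `379/2500` | `81.2803…°` | `81.54` |
| 14 | `1711/10000` | `80.1482…°` | `80.30` |
| 15 | `467/2500` | `79.2339…°` | `79.30` |

One-sided certified bounds (no configuration side is formalised for `S⁴` in the tree); not optimality claims.

## References
* C. Bachoc, F. Vallentin, New upper bounds for kissing numbers from semidefinite programming,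
  J. Amer. Math. Soc. 21 (2008), Theorem 4.2. [`BachocVallentin2007`]
* F. Pfender, Improved Delsarte bounds for spherical codes in small dimensions, J. Combin. Theory Ser. A 114 (2007), Table 2.
-/

noncomputable section

open Finset
open scoped RealInnerProductSpace

namespace Summit.Ventures.PackingBounds.SphericalCodes

/-- **`S⁴`, `N = 11`, inner products**: among any `11` or more unit vectors of `ℝ⁵`, two distinct ones have inner product
`> 931/10000`. -/
theorem sphereFour11_exists_inner_gt (C : Finset (EuclideanSpace ℝ (Fin 5)))
    (h1 : ∀ x ∈ C, ‖x‖ = 1) (hC : 10 < C.card) :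
    ∃ x ∈ C, ∃ y ∈ C, x ≠ y ∧ (931 / 10000 : ℝ) < inner ℝ x y :=
  exists_inner_gt_of_codeBound ThreePointCert.S4T11.tammesS4_11_card_le_10_sdp C h1 hC

/-- **`S⁴`, `N = 11`, angles**: among any `11` or more unit vectors of `ℝ⁵`, two distinct ones make an (unoriented) angle
`< arccos(931/10000)` (`= 84.6580…°`; Pfender 2007 Table 2 prints `85.39°`). -/
theorem sphereFour11_exists_angle_lt_arccos (C : Finset (EuclideanSpace ℝ (Fin 5)))
    (h1 : ∀ x ∈ C, ‖x‖ = 1) (hC : 10 < C.card) :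
    ∃ x ∈ C, ∃ y ∈ C, x ≠ y ∧ InnerProductGeometry.angle x y < Real.arccos (931 / 10000) :=
  exists_angle_lt_arccos_of_codeBound ThreePointCert.S4T11.tammesS4_11_card_le_10_sdp
    (by norm_num) C h1 hC

/-- **`θ_11(S⁴) < arccos(931/10000)`**: any common lower bound `θ` for the pairwise angles of `11` or more unit vectors of `ℝ⁵`
satisfies `θ < arccos(931/10000)` (`= 84.6580…°`). -/
theorem sphereFour11_minAngle_lt_arccos (C : Finset (EuclideanSpace ℝ (Fin 5)))
    (h1 : ∀ x ∈ C, ‖x‖ = 1) (hC : 10 < C.card) (θ : ℝ)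
    (hθ : ∀ x ∈ C, ∀ y ∈ C, x ≠ y → θ ≤ InnerProductGeometry.angle x y) :
    θ < Real.arccos (931 / 10000) :=
  minAngle_lt_arccos_of_codeBound ThreePointCert.S4T11.tammesS4_11_card_le_10_sdp
    (by norm_num) C h1 hC θ hθ

/-- **`S⁴`, `N = 12`, inner products**: among any `12` or more unit vectors of `ℝ⁵`, two distinct ones have inner product
`> 631/5000`. -/
theorem sphereFour12_exists_inner_gt (C : Finset (EuclideanSpace ℝ (Fin 5)))
    (h1 : ∀ x ∈ C, ‖x‖ = 1) (hC : 11 < C.card) :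
    ∃ x ∈ C, ∃ y ∈ C, x ≠ y ∧ (631 / 5000 : ℝ) < inner ℝ x y :=
  exists_inner_gt_of_codeBound ThreePointCert.S4T12.tammesS4_12_card_le_11_sdp C h1 hC

/-- **`S⁴`, `N = 12`, angles**: among any `12` or more unit vectors of `ℝ⁵`, two distinct ones make an (unoriented) angle
`< arccos(631/5000)` (`= 82.7499…°`; Pfender 2007 Table 2 prints `83.14°`). -/
theorem sphereFour12_exists_angle_lt_arccos (C : Finset (EuclideanSpace ℝ (Fin 5)))
    (h1 : ∀ x ∈ C, ‖x‖ = 1) (hC : 11 < C.card) :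
    ∃ x ∈ C, ∃ y ∈ C, x ≠ y ∧ InnerProductGeometry.angle x y < Real.arccos (631 / 5000) :=
  exists_angle_lt_arccos_of_codeBound ThreePointCert.S4T12.tammesS4_12_card_le_11_sdp
    (by norm_num) C h1 hC

/-- **`θ_12(S⁴) < arccos(631/5000)`**: any common lower bound `θ` for the pairwise angles of `12` or more unit vectors of `ℝ⁵`
satisfies `θ < arccos(631/5000)` (`= 82.7499…°`). -/
theorem sphereFour12_minAngle_lt_arccos (C : Finset (EuclideanSpace ℝ (Fin 5)))
    (h1 : ∀ x ∈ C, ‖x‖ = 1) (hC : 11 < C.card) (θ : ℝ)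
    (hθ : ∀ x ∈ C, ∀ y ∈ C, x ≠ y → θ ≤ InnerProductGeometry.angle x y) :
    θ < Real.arccos (631 / 5000) :=
  minAngle_lt_arccos_of_codeBound ThreePointCert.S4T12.tammesS4_12_card_le_11_sdp
    (by norm_num) C h1 hC θ hθ

/-- **`S⁴`, `N = 13`, inner products**: among any `13` or more unit vectors of `ℝ⁵`, two distinct ones have inner product
`> 379/2500`. -/
theorem sphereFour13_exists_inner_gt (C : Finset (EuclideanSpace ℝ (Fin 5)))
    (h1 : ∀ x ∈ C, ‖x‖ = 1) (hC : 12 < C.card) :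
    ∃ x ∈ C, ∃ y ∈ C, x ≠ y ∧ (379 / 2500 : ℝ) < inner ℝ x y :=
  exists_inner_gt_of_codeBound ThreePointCert.S4T13.tammesS4_13_card_le_12_sdp C h1 hC

/-- **`S⁴`, `N = 13`, angles**: among any `13` or more unit vectors of `ℝ⁵`, two distinct ones make an (unoriented) angle
`< arccos(379/2500)` (`= 81.2803…°`; Pfender 2007 Table 2 prints `81.54°`). -/
theorem sphereFour13_exists_angle_lt_arccos (C : Finset (EuclideanSpace ℝ (Fin 5)))
    (h1 : ∀ x ∈ C, ‖x‖ = 1) (hC : 12 < C.card) :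
    ∃ x ∈ C, ∃ y ∈ C, x ≠ y ∧ InnerProductGeometry.angle x y < Real.arccos (379 / 2500) :=
  exists_angle_lt_arccos_of_codeBound ThreePointCert.S4T13.tammesS4_13_card_le_12_sdp
    (by norm_num) C h1 hC

/-- **`θ_13(S⁴) < arccos(379/2500)`**: any common lower bound `θ` for the pairwise angles of `13` or more unit vectors of `ℝ⁵`
satisfies `θ < arccos(379/2500)` (`= 81.2803…°`). -/
theorem sphereFour13_minAngle_lt_arccos (C : Finset (EuclideanSpace ℝ (Fin 5)))
    (h1 : ∀ x ∈ C, ‖x‖ = 1) (hC : 12 < C.card) (θ : ℝ)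
    (hθ : ∀ x ∈ C, ∀ y ∈ C, x ≠ y → θ ≤ InnerProductGeometry.angle x y) :
    θ < Real.arccos (379 / 2500) :=
  minAngle_lt_arccos_of_codeBound ThreePointCert.S4T13.tammesS4_13_card_le_12_sdp
    (by norm_num) C h1 hC θ hθ

/-- **`S⁴`, `N = 14`, inner products**: among any `14` or more unit vectors of `ℝ⁵`, two distinct ones have inner product
`> 1711/10000`. -/
theorem sphereFour14_exists_inner_gt (C : Finset (EuclideanSpace ℝ (Fin 5)))
    (h1 : ∀ x ∈ C, ‖x‖ = 1) (hC : 13 < C.card) :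
    ∃ x ∈ C, ∃ y ∈ C, x ≠ y ∧ (1711 / 10000 : ℝ) < inner ℝ x y :=
  exists_inner_gt_of_codeBound ThreePointCert.S4T14.tammesS4_14_card_le_13_sdp C h1 hC

/-- **`S⁴`, `N = 14`, angles**: among any `14` or more unit vectors of `ℝ⁵`, two distinct ones make an (unoriented) angle
`< arccos(1711/10000)` (`= 80.1482…°`; Pfender 2007 Table 2 prints `80.30°`). -/
theorem sphereFour14_exists_angle_lt_arccos (C : Finset (EuclideanSpace ℝ (Fin 5)))
    (h1 : ∀ x ∈ C, ‖x‖ = 1) (hC : 13 < C.card) :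
    ∃ x ∈ C, ∃ y ∈ C, x ≠ y ∧ InnerProductGeometry.angle x y < Real.arccos (1711 / 10000) :=
  exists_angle_lt_arccos_of_codeBound ThreePointCert.S4T14.tammesS4_14_card_le_13_sdp
    (by norm_num) C h1 hC

/-- **`θ_14(S⁴) < arccos(1711/10000)`**: any common lower bound `θ` for the pairwise angles of `14` or more unit vectors of `ℝ⁵`
satisfies `θ < arccos(1711/10000)` (`= 80.1482…°`). -/
theorem sphereFour14_minAngle_lt_arccos (C : Finset (EuclideanSpace ℝ (Fin 5)))
    (h1 : ∀ x ∈ C, ‖x‖ = 1) (hC : 13 < C.card) (θ : ℝ)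
    (hθ : ∀ x ∈ C, ∀ y ∈ C, x ≠ y → θ ≤ InnerProductGeometry.angle x y) :
    θ < Real.arccos (1711 / 10000) :=
  minAngle_lt_arccos_of_codeBound ThreePointCert.S4T14.tammesS4_14_card_le_13_sdp
    (by norm_num) C h1 hC θ hθ

/-- **`S⁴`, `N = 15`, inner products**: among any `15` or more unit vectors of `ℝ⁵`, two distinct ones have inner product
`> 467/2500`. -/
theorem sphereFour15_exists_inner_gt (C : Finset (EuclideanSpace ℝ (Fin 5)))
    (h1 : ∀ x ∈ C, ‖x‖ = 1) (hC : 14 < C.card) :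
    ∃ x ∈ C, ∃ y ∈ C, x ≠ y ∧ (467 / 2500 : ℝ) < inner ℝ x y :=
  exists_inner_gt_of_codeBound ThreePointCert.S4T15.tammesS4_15_card_le_14_sdp C h1 hC

/-- **`S⁴`, `N = 15`, angles**: among any `15` or more unit vectors of `ℝ⁵`, two distinct ones make an (unoriented) angle
`< arccos(467/2500)` (`= 79.2339…°`; Pfender 2007 Table 2 prints `79.30°`). -/
theorem sphereFour15_exists_angle_lt_arccos (C : Finset (EuclideanSpace ℝ (Fin 5)))
    (h1 : ∀ x ∈ C, ‖x‖ = 1) (hC : 14 < C.card) :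
    ∃ x ∈ C, ∃ y ∈ C, x ≠ y ∧ InnerProductGeometry.angle x y < Real.arccos (467 / 2500) :=
  exists_angle_lt_arccos_of_codeBound ThreePointCert.S4T15.tammesS4_15_card_le_14_sdp
    (by norm_num) C h1 hC

/-- **`θ_15(S⁴) < arccos(467/2500)`**: any common lower bound `θ` for the pairwise angles of `15` or more unit vectors of `ℝ⁵`
satisfies `θ < arccos(467/2500)` (`= 79.2339…°`). -/
theorem sphereFour15_minAngle_lt_arccos (C : Finset (EuclideanSpace ℝ (Fin 5)))
    (h1 : ∀ x ∈ C, ‖x‖ = 1) (hC : 14 < C.card) (θ : ℝ)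
    (hθ : ∀ x ∈ C, ∀ y ∈ C, x ≠ y → θ ≤ InnerProductGeometry.angle x y) :
    θ < Real.arccos (467 / 2500) :=
  minAngle_lt_arccos_of_codeBound ThreePointCert.S4T15.tammesS4_15_card_le_14_sdp
    (by norm_num) C h1 hC θ hθ

end Summit.Ventures.PackingBounds.SphericalCodes

end
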